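import Summits.ValiantsHypothesis.ValiantsHypothesis.Theorems.BarrierLeverAnchoredDoorHitsLowerPairsThinSide
import Summits.ValiantsHypothesis.ValiantsHypothesis.Theorems.BarrierLeverPartitionMinorsHitByVPLayoutSwap

/-!
# Route BarrierLever — item `PartitionMinorsHitByVP` (stmt-ValiantsHypothesis-19717):
# ALL THIN-ROW LAYOUTS ARE HIT — rows of size `≤ s`, columns arbitrary, every constant `s`, every `h ≥ 9(s+1)²`

Helper file (`--supports stmt-ValiantsHypothesis-19717`; cell valiant-natproofs, rung V4, 𝒟-side door (c); prover seat val-np-p4 gen 16).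
Definition-free. Closes NO item.

THE CLASS (`partitionMinor_hit_of_card_le`): for every `s ≥ 1` and `h ≥ 9(s+1)²`, EVERY injective layout `(u, w)` of height `h` whose
ROWS all have size `≤ s` (the columns `w j ⊆ Fin h` are arbitrary distinct sets, no lower-set or emptiness condition) has a nonzero
partition minor at some `f ∈ SmallCircuits ℂ (h+h) (2s+8)`; and the transpose class (`partitionMinor_hit_of_card_le_col`: all
COLUMNS of size `≤ s`). For `s = 2` this is the «thin-row» class of the refuted Chow rungs 20195 (h+h affine forms; refuted-misstated,
val-np-p2 g9) / 21850 (h·h forms; open): thin-row layouts ARE hit by small circuits — by the anchored door 𝔄₂ times at most `h`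
linear factors, truncated — though not (as those items ask) by ONE product of affine forms.

PROOF. The matched-emptiness case is `ProductRule.exists_smallCircuit_of_card_le` (the product-rule theorem of
`…AnchoredDoorHitsLowerPairsThinSide`: 𝔄_s itself, truncated). If `∅` is a row but no column is empty, compress the COLUMNS down to
a simplicial complex (val-np-p1 g12's `DownCompression.iterate_y`, verbatim): the compressed layout is matched, and each of the `≤ h`
compression steps is undone by a factor `1 + t·y_c` (`step_y`). If `∅` is a column but no row is empty, compress the ROWS instead —
`iterate_x_card_le` is `DownCompression.iterate_x` with the invariant «rows of size `≤ s`» threaded through (erasing never enlarges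
a set). Finally truncate to degree `≤ 2h` (`AdditiveDoor.truncation_spec`) with the size arithmetic `DownCompression.size_le_pow`.
The transpose class follows from the `x ↔ y` symmetry of partition minors (val-np-p1's `LayoutSwap.smallCircuits_hit_swap`).

WHAT THIS IS NOT: thick rows against thick columns are the open content of item 19717 (lines hidden_states / anchored_peeling); nothing
here closes 19717, 21850 or 21882; nothing on crux stmt-ValiantsHypothesis-14610 or on `VP` versus `VNP`.
-/

set_option linter.dupNamespace false

namespace Summit.ValiantsHypothesis.ValiantsHypothesis.Theorems.BarrierLever.AnchoredPeeling

open Finset MvPolynomial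
open Literature.Barriers.ValiantsHypothesis (SmallCircuits)
open Literature.Computability.AlgebraicComplexity (complexity)
open Summit.ValiantsHypothesis.ValiantsHypothesis.Theorems.BarrierLever.AdditiveDoor (truncation_spec degree_partitionExpo_le)
open Summit.ValiantsHypothesis.ValiantsHypothesis.Theorems.BarrierLever.DownCompression
  (iterate_y step_x injective_of_compOf isComp_of_compOf isComp_of_compOf_of_isComp isLowerSet_range_of_isComp
   bounds_mul_one_add_C_mul_X size_le_pow)
open Summit.ValiantsHypothesis.ValiantsHypothesis.Theorems.BarrierLever.LayoutSwap (smallCircuits_hit_swap)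

noncomputable section

namespace ProductRule

variable {h r : ℕ}

/-! ## 1. Row compressions preserving thin rows -/

/-- **All row compressions, thin rows preserved** (val-np-p1 g12's `DownCompression.iterate_x` with the invariant `|u i| ≤ s'`
threaded through: a compression replaces a row by an erasure of it, which is not larger). Fix the columns `w`. If every injective
row family with lower-set range and rows of size `≤ s'` is hit against `w` at size `≤ sz` and degree `≤ d`, then every injective
row family with rows of size `≤ s'` that is already `a`-compressed for the coordinates `a` with `a + m < h` is hit at size
`≤ sz + 3m`, degree `≤ d + m`. -/
theorem iterate_x_card_le (w : Fin r → Finset (Fin h)) (s' sz d : ℕ)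
    (hyp : ∀ v : Fin r → Finset (Fin h), Function.Injective v → IsLowerSet (Set.range v) → (∀ i, (v i).card ≤ s') →
      ∃ f : MvPolynomial (Fin (h + h)) ℂ, complexity f ≤ sz ∧ f.totalDegree ≤ d ∧
        (Matrix.of fun i j : Fin r => MvPolynomial.coeff
          (∑ a ∈ v i, Finsupp.single (Fin.castAdd h a) 1 +
            ∑ c ∈ w j, Finsupp.single (Fin.natAdd h c) 1) f).det ≠ 0) :
    ∀ m : ℕ, m ≤ h → ∀ u : Fin r → Finset (Fin h), Function.Injective u → (∀ i, (u i).card ≤ s') →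
      (∀ a : Fin h, a.val + m < h → ∀ i, a ∈ u i → ∃ k, u k = (u i).erase a) →
      ∃ f : MvPolynomial (Fin (h + h)) ℂ, complexity f ≤ sz + 3 * m ∧ f.totalDegree ≤ d + m ∧
        (Matrix.of fun i j : Fin r => MvPolynomial.coeff
          (∑ a ∈ u i, Finsupp.single (Fin.castAdd h a) 1 +
            ∑ c ∈ w j, Finsupp.single (Fin.natAdd h c) 1) f).det ≠ 0 := by
  classical
  intro m
  induction m with
  | zero =>
    intro _ u hu hthin hcomp
    have hlow : IsLowerSet (Set.range u) :=
      isLowerSet_range_of_isComp u (fun a i hai => hcomp a (by have := a.isLt; omega) i hai)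
    obtain ⟨f, hfs, hfd, hf⟩ := hyp u hu hlow hthin
    exact ⟨f, by omega, by omega, hf⟩
  | succ m ih =>
    intro hm u hu hthin hcomp
    -- compress the coordinate `a₀ = h - (m + 1)`
    set a₀ : Fin h := ⟨h - (m + 1), by omega⟩ with ha₀_def
    let v : Fin r → Finset (Fin h) := fun i =>
      if a₀ ∈ u i ∧ ∀ k, u k ≠ (u i).erase a₀ then (u i).erase a₀ else u i
    have hv₁ : ∀ i, a₀ ∈ u i → (∀ k, u k ≠ (u i).erase a₀) → v i = (u i).erase a₀ :=
      fun i h1 h2 => by simp only [v, if_pos (And.intro h1 h2)]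
    have hv₂ : ∀ i, ¬ (a₀ ∈ u i ∧ ∀ k, u k ≠ (u i).erase a₀) → v i = u i :=
      fun i h1 => by simp only [v, if_neg h1]
    have hv_inj : Function.Injective v := injective_of_compOf u v a₀ hu hv₁ hv₂
    have hv_thin : ∀ i, (v i).card ≤ s' := fun i => by
      by_cases hi : a₀ ∈ u i ∧ ∀ k, u k ≠ (u i).erase a₀
      · rw [hv₁ i hi.1 hi.2]; exact (Finset.card_erase_le).trans (hthin i)
      · rw [hv₂ i hi]; exact hthin i
    have hv_comp : ∀ a : Fin h, a.val + m < h → ∀ i, a ∈ v i → ∃ k, v k = (v i).erase a := by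
      intro a ha
      by_cases haa : a = a₀
      · subst haa
        exact isComp_of_compOf u v _ hv₁ hv₂
      · have ha' : a.val + (m + 1) < h := by
          have : a.val ≠ h - (m + 1) := fun hv => haa (Fin.ext (by rw [hv, ha₀_def]))
          omega
        exact isComp_of_compOf_of_isComp u v a a₀ (hcomp a ha') hv₁ hv₂
    obtain ⟨f, hfs, hfd, hf⟩ := ih (by omega) v hv_inj hv_thin hv_comp
    obtain ⟨t, ht⟩ := step_x u v w a₀ hv₁ hv₂ f hf
    obtain ⟨hs', hd'⟩ := bounds_mul_one_add_C_mul_X f t (Fin.castAdd h a₀) _ _ hfs hfd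
    exact ⟨f * (1 + C t * X (Fin.castAdd h a₀)), by omega, by omega, ht⟩

/-! ## 2. All thin-row layouts -/

/-- A nonempty lower-set family contains `∅`. -/
theorem exists_eq_empty_of_lowerSet (v : Fin r → Finset (Fin h)) (hlv : IsLowerSet (Set.range v)) (i : Fin r) :
    ∃ k, v k = ∅ := by
  obtain ⟨k, hk⟩ : (∅ : Finset (Fin h)) ∈ Set.range v := hlv (Finset.empty_subset (v i)) ⟨i, rfl⟩
  exact ⟨k, hk⟩

/-- **Pre-truncation witness for every thin-row layout** (`s ≥ 1`, `h ≥ 9(s+1)²`): size `≤ (2h)^{2s+4} + 3h`, degree `≤ 3h`. -/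
theorem exists_witness_of_card_le (s h : ℕ) (hs : 1 ≤ s) (hh : 9 * (s + 1) ^ 2 ≤ h) (r : ℕ)
    (u w : Fin r → Finset (Fin h)) (hu : Function.Injective u) (hw : Function.Injective w)
    (hthin : ∀ i, (u i).card ≤ s) :
    ∃ f : MvPolynomial (Fin (h + h)) ℂ, complexity f ≤ (h + h) ^ (2 * s + 4) + 3 * h ∧
      f.totalDegree ≤ (h + h) + h ∧
      (Matrix.of fun i j : Fin r => MvPolynomial.coeff
        (∑ a ∈ u i, Finsupp.single (Fin.castAdd h a) 1 + ∑ c ∈ w j, Finsupp.single (Fin.natAdd h c) 1) f).det ≠ 0 := by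
  -- the matched case, with explicit bounds
  have matched : ∀ (v w' : Fin r → Finset (Fin h)), Function.Injective v → Function.Injective w' →
      (∀ i, (v i).card ≤ s) → ((∃ i, v i = ∅) ↔ (∃ j, w' j = ∅)) →
      ∃ f : MvPolynomial (Fin (h + h)) ℂ, complexity f ≤ (h + h) ^ (2 * s + 4) ∧ f.totalDegree ≤ h + h ∧
        (Matrix.of fun i j : Fin r => MvPolynomial.coeff
          (∑ a ∈ v i, Finsupp.single (Fin.castAdd h a) 1 + ∑ c ∈ w' j, Finsupp.single (Fin.natAdd h c) 1) f).det ≠ 0 := by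
    intro v w' hv hw' hvthin hemp
    obtain ⟨f, ⟨hfd, hfs⟩, hf⟩ := exists_smallCircuit_of_card_le s h hs hh r v w' hv hw' hvthin hemp
    exact ⟨f, hfs, hfd, hf⟩
  by_cases hU : ∃ i, u i = ∅
  · -- compress the columns (every lower column family is matched with the empty row)
    obtain ⟨i₀, hi₀⟩ := hU
    obtain ⟨f, hfs, hfd, hf⟩ := iterate_y u ((h + h) ^ (2 * s + 4)) (h + h)
      (fun w' hw' hlw' => matched u w' hu hw' hthin
        ⟨fun _ => exists_eq_empty_of_lowerSet w' hlw' i₀, fun _ => ⟨i₀, hi₀⟩⟩)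
      h le_rfl w hw (fun c hc => absurd hc (by omega))
    exact ⟨f, hfs, by omega, hf⟩
  · by_cases hW : ∃ j, w j = ∅
    · -- compress the rows, keeping them thin (every lower row family is matched with the empty column)
      obtain ⟨j₀, hj₀⟩ := hW
      obtain ⟨f, hfs, hfd, hf⟩ := iterate_x_card_le w s ((h + h) ^ (2 * s + 4)) (h + h)
        (fun v hv hlv hvthin => matched v w hv hw hvthin
          ⟨fun _ => ⟨j₀, hj₀⟩, fun _ => exists_eq_empty_of_lowerSet v hlv j₀⟩)
        h le_rfl u hu hthin (fun a ha => absurd ha (by omega))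
      exact ⟨f, hfs, by omega, hf⟩
    · -- no empty set on either side: matched
      obtain ⟨f, hfs, hfd, hf⟩ := matched u w hu hw hthin ⟨fun h1 => absurd h1 hU, fun h2 => absurd h2 hW⟩
      exact ⟨f, by omega, by omega, hf⟩

/-- **ALL THIN-ROW LAYOUTS ARE HIT (a certified class for item 19717).** For every `s ≥ 1` and `h ≥ 9(s+1)²`, every injective
layout whose rows all have size `≤ s` — columns arbitrary — has a nonzero partition minor at some `f ∈ SmallCircuits ℂ (h+h) (2s+8)`. -/
theorem partitionMinor_hit_of_card_le (s h : ℕ) (hs : 1 ≤ s) (hh : 9 * (s + 1) ^ 2 ≤ h) (r : ℕ)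
    (u w : Fin r → Finset (Fin h)) (hu : Function.Injective u) (hw : Function.Injective w)
    (hthin : ∀ i, (u i).card ≤ s) :
    ∃ f ∈ SmallCircuits ℂ (h + h) (2 * s + 8),
      (Matrix.of fun i j : Fin r => MvPolynomial.coeff
        (∑ a ∈ u i, Finsupp.single (Fin.castAdd h a) 1 + ∑ c ∈ w j, Finsupp.single (Fin.natAdd h c) 1) f).det ≠ 0 := by
  have hs1 : 1 ≤ (s + 1) ^ 2 := Nat.one_le_pow _ _ (by omega)
  have h4 : 4 ≤ h := le_trans (by nlinarith [hs1]) hh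
  obtain ⟨g, hgs, hgd, hg⟩ := exists_witness_of_card_le s h hs hh r u w hu hw hthin
  obtain ⟨hdeg, hcoeff, hsize⟩ := truncation_spec g (h + h)
  refine ⟨∑ e ∈ Finset.range (h + h + 1), homogeneousComponent e g, ⟨hdeg, ?_⟩, ?_⟩
  · calc complexity (∑ e ∈ Finset.range (h + h + 1), homogeneousComponent e g)
        ≤ (h + h + 2) ^ 2 * complexity g + (h + h + 1) := hsize
      _ ≤ (h + h + 2) ^ 2 * ((h + h) ^ (2 * s + 4) + 6 * h) + (h + h + 1) := by gcongr; omega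
      _ ≤ (h + h) ^ (2 * s + 4 + 4) := size_le_pow h (2 * s + 4) h4
      _ = (h + h) ^ (2 * s + 8) := by ring_nf
  · have hmat : (Matrix.of fun i j : Fin r => MvPolynomial.coeff
        (∑ a ∈ u i, Finsupp.single (Fin.castAdd h a) 1 +
          ∑ c ∈ w j, Finsupp.single (Fin.natAdd h c) 1)
        (∑ e ∈ Finset.range (h + h + 1), homogeneousComponent e g)) =
        Matrix.of fun i j : Fin r => MvPolynomial.coeff
          (∑ a ∈ u i, Finsupp.single (Fin.castAdd h a) 1 +
            ∑ c ∈ w j, Finsupp.single (Fin.natAdd h c) 1) g := by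
      ext i j
      rw [Matrix.of_apply, Matrix.of_apply, hcoeff _ (degree_partitionExpo_le _ _)]
    rw [hmat]
    exact hg

/-- **ALL THIN-COLUMN LAYOUTS ARE HIT** (the transpose class, by the `x ↔ y` swap `LayoutSwap.smallCircuits_hit_swap`): for every
`s ≥ 1` and `h ≥ 9(s+1)²`, every injective layout whose columns all have size `≤ s` — rows arbitrary — is hit inside
`SmallCircuits ℂ (h+h) (2s+8)`. -/
theorem partitionMinor_hit_of_card_le_col (s h : ℕ) (hs : 1 ≤ s) (hh : 9 * (s + 1) ^ 2 ≤ h) (r : ℕ)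
    (u w : Fin r → Finset (Fin h)) (hu : Function.Injective u) (hw : Function.Injective w)
    (hthin : ∀ j, (w j).card ≤ s) :
    ∃ f ∈ SmallCircuits ℂ (h + h) (2 * s + 8),
      (Matrix.of fun i j : Fin r => MvPolynomial.coeff
        (∑ a ∈ u i, Finsupp.single (Fin.castAdd h a) 1 + ∑ c ∈ w j, Finsupp.single (Fin.natAdd h c) 1) f).det ≠ 0 :=
  smallCircuits_hit_swap w u (partitionMinor_hit_of_card_le s h hs hh r w u hw hu hthin)

/-- **Eventual form** (the shape of item 19717 restricted to the class): for every `s` there are `b, h₀` such that for `h ≥ h₀` every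
injective layout with all rows of size `≤ s`, or all columns of size `≤ s`, is hit inside `SmallCircuits ℂ (h+h) b`. -/
theorem partitionMinor_hit_of_card_le_eventually (s : ℕ) :
    ∃ b h₀ : ℕ, ∀ h : ℕ, h₀ ≤ h → ∀ (r : ℕ) (u w : Fin r → Finset (Fin h)),
      Function.Injective u → Function.Injective w → ((∀ i, (u i).card ≤ s) ∨ (∀ j, (w j).card ≤ s)) →
      ∃ f ∈ SmallCircuits ℂ (h + h) b,
        (Matrix.of fun i j : Fin r => MvPolynomial.coeff
          (∑ a ∈ u i, Finsupp.single (Fin.castAdd h a) 1 + ∑ c ∈ w j, Finsupp.single (Fin.natAdd h c) 1) f).det ≠ 0 := by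
  refine ⟨2 * (s + 1) + 8, 9 * (s + 1 + 1) ^ 2, fun h hh r u w hu hw hthin => ?_⟩
  rcases hthin with hrow | hcol
  · exact partitionMinor_hit_of_card_le (s + 1) h (by omega) hh r u w hu hw (fun i => (hrow i).trans (Nat.le_succ s))
  · exact partitionMinor_hit_of_card_le_col (s + 1) h (by omega) hh r u w hu hw (fun j => (hcol j).trans (Nat.le_succ s))

end ProductRule

end

end Summit.ValiantsHypothesis.ValiantsHypothesis.Theorems.BarrierLever.AnchoredPeeling
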